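import Summits.NavierStokesRegularity.NavierStokesRegularity.Theses.CalmSliceGate
import HarnessLib

/-!
# Route CalmSliceGate, item `PerpetualFlickerLiouvilleGlue` (stmt-NavierStokesRegularity-24454)

Pure logic: the split of `PerpetualFlickerLiouville` into `OneSymmetricSlice` (some slice is
`δ'`-almost axisymmetric about some axis through the apex on the similarity ball
`B(0, R'√(-t))`) and `AsymmetricFlickerLiouville` (every slice is `δ'`-far from every such
symmetry) is exhaustive: obtain `δ', R'` from `OneSymmetricSlice C K` and decide by excluded middle.

Nothing here bears on the Navier–Stokes regularity problem itself.
-/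

set_option linter.dupNamespace false

namespace Summit.NavierStokesRegularity.NavierStokesRegularity.Theorems

open Summit.NavierStokesRegularity.NavierStokesRegularity.Theses.CalmSliceGate

/-- **`CalmSliceGate.PerpetualFlickerLiouvilleGlue`** (stmt-NavierStokesRegularity-24454):
`OneSymmetricSlice → AsymmetricFlickerLiouville → PerpetualFlickerLiouville` (excluded middle on
the existence of one almost-axisymmetric slice). [folklore] -/
theorem calmSliceGate_perpetualFlickerLiouvilleGlue_proof :
    Summit.NavierStokesRegularity.NavierStokesRegularity.Theses.CalmSliceGate.PerpetualFlickerLiouvilleGlue := by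
  intro hS hA C K δ R hδ hR w hw hlaw hflick
  obtain ⟨δ', hδ', R', hR', hS'⟩ := hS C K
  by_cases hsym : ∃ t < 0, ∃ g : EuclideanSpace ℝ (Fin 3) ≃ₗᵢ[ℝ] EuclideanSpace ℝ (Fin 3),
      ∀ θ : ℝ, ∀ x ∈ Metric.ball (0 : EuclideanSpace ℝ (Fin 3)) (R' * Real.sqrt (-t)),
        Real.sqrt (-t) * ‖w t (g (Literature.Analysis.FluidPDE.rotZ θ (g.symm x))) -
          g (Literature.Analysis.FluidPDE.rotZ θ (g.symm (w t x)))‖ ≤ δ'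
  · exact hS' w hw hlaw hsym
  · refine hA C K δ R δ' R' hδ hR hδ' hR' w hw hlaw hflick ?_
    intro t ht g
    by_contra hcon
    push Not at hcon
    exact hsym ⟨t, ht, g, fun θ x hx => hcon θ x hx⟩

end Summit.NavierStokesRegularity.NavierStokesRegularity.Theorems
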